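import Summits.PneNP.PneNP.Theorems.NegLimitedAmplifiedWindowAmpDefs
import Summits.PneNP.PneNP.Theorems.NegLimitedAmplifiedWindowBiasSeq
import Summits.PneNP.PneNP.Theorems.NegLimitedAmplifiedWindowCriticalWindow
import Mathlib
import HarnessLib

/-!
# Route NegLimited — line `half-window` on the rung R2 `NegLimited.NeglimitedHalfLogNegationsR`:
shared OBJECTS and stub STATEMENTS (rung F-N1/p3, ROUND-13; item stmt-PneNP-19888, rank 3)

The objects and the seven statements of pnp-ideate-p3's registered skeleton `half-window`
(HOME/pnp-ideate-p3/r13/half-window.lean, sha16 0a142adbfebe452b, `ledger skeleton check` OK 2026-08-27T02:25Z;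
card r13/half-window.md; memo ROUND-13.md; typed sketch r13/Sketch-R13.lean) VERBATIM, landed once so that every
stub file (`stub_tribesBiasResponse`, `stub_tribesRM3Count`, `stub_tribesNumericsCal`, `stub_monotoneAmplificationGen`,
`stub_halfEngineAssembly`, `stub_halfSlicesNP`, `stub_halfDoorAssembly`) and the closer share the SAME constants
(`expAbsBiasGen`, `tribes`, `tribesRM3`, `mCal`, `dCal`, `wOf`, `HBlk`, `hP`, `halfFn`, `halfLen`, `tbRHS` are local
objects of the line — re-declaring them per file would leave their identification to definitional unfolding).
This is the R2 analogue of `NegLimitedAmplifiedWindowDefs.lean` (p465934) for the door.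

R2: for every `ε > 0` an NP language with monotone slices needs super-polynomial De Morgan circuits of UNBOUNDED
depth when only `⌊(1/2 − ε)·log₂ n⌋` NOT gates are allowed (Rossman CCC 2015 Cor. 1.4 has this constant for NC¹ only).

THE LINE (one sentence, p3): run the door's engine once more with the amplifier `TRIBES_{w,m} ∘ RM3_d^{m·w}`,
`d = Θ(log w)`, whose expected restricted bias is `Õ(k^{-1/2})` by an EXACT second-moment identity (subtree
independence), so that the landed base hardness (B, `stub_criticalWindow`) + GENERIC monotone amplification (A-gen)
+ the in-tree GAP-form negation transfer (no exact balance needed) give correlation `ℓ^{-(1/2-ε)}` hence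
`(1/2 − ε)·log₂ ℓ` negations.

Statements (each a registered stub of the line; NOT proved here):
* `MonotoneAmplificationGen` (A-gen): `MonotoneAmplification` with an abstract monotone combiner — the landed
  `Amp*` files are already generic in `Φ`; only the final composition changes (`+1` size hypothesis kills the size-0 corner).
* `TribesBiasResponse` (TB): THE new estimate (exact identities checked on 37 small cases by p3, folder/tb_check.py).
* `TribesNumericsCal` (N): real-analysis calibration with the explicit `mCal`, `dCal`.
* `TribesRM3Count` (C): exact number of ones of `TRIBES ∘ RM3` (self-duality of RM3 + independence).
* `HalfEngineAssembly` (EA′): B + A-gen + TB + N + C ⟹ the engine output `HalfEngine`.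
* `HalfSlicesNP` (S′): NP language whose slice at `halfLen n kc r` retracts onto `halfFn n kc r` (clone of
  prover-2's `SlicesVerifier/SlicesEval/SlicesNP`; length code `2^{pair r kc}·(2·hP·n²+1)` is uniquely decodable).
* `HalfDoorAssembly` (DA′): gap transfer + slices + engine ⟹ R2 (asymptotics bookkeeping, as the door's DA).
PROVED here: the gap-form transfer `gapTransfer_holds : GapNegationsTransfer` (from the tree's
`NegLimitedDoor.one_le_negations_mul_gap`), monotonicity of the combiner, and the composition
`NeglimitedHalfLogNegationsR_of` (the seven statements conclude the crux BY NAME; p3's kernel-checked modus ponens).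

References: B. Rossman, *Correlation bounds against monotone NC¹*, CCC 2015, Cor. 1.4 and p. 395
[Rossman2015CorrelationMonotoneNC1]; R. O'Donnell, *Hardness amplification within NP*, JCSS 69 (2004), Thm 2 / §3
[ODonnell2004]; K. Amano, A. Maruoka, SIAM J. Comput. 35 (2005) [AmanoMaruoka2005].

HONEST FRAMING: statements and bookkeeping objects of a registered LINE on an OPEN rung item; A-gen, TB, N, C, EA′, S′,
DA′ are NOT proved here; FRONTIER rung F-N1 — nothing here bears on P vs NP; the method's ceiling is `(1/2)·log₂ n`
negations (O'Donnell–Wimmer, Rossman 2015 p. 395), so R2 is the last rung of this ladder (ROUND-13 §3).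
-/

set_option linter.dupNamespace false -- `Summit.PneNP.PneNP.…`: summit = sub-problem name (D-0017 single-conjunct layout)

namespace Summit.PneNP.PneNP.Theorems.NegLimitedHalfWindow

open Finset Filter
open Literature.Computability.Complexity
open Summit.PneNP.PneNP.Theorems.NegLimitedDoor (massAt agreeAt jointAt condGap)
open Summit.PneNP.PneNP.Theorems.NegLimitedAmplifiedWindow
  (Edge recMaj3 recMaj3_monotone biasSeq CriticalWindowHardness stub_criticalWindow)
open Summit.PneNP.PneNP.Theorems.NegLimitedAmplifiedWindow.Amp (bw cbias)

/-! ## Objects -/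

section Generic
variable {W : Type} [Fintype W] [DecidableEq W]

/-- Expected absolute bias of an arbitrary combiner `Φ` under the `p`-random restriction with fair fixed bits
(`Amp.expAbsBias d p` is the case `Φ = recMaj3 d`). -/
noncomputable def expAbsBiasGen (Φ : (W → Bool) → Bool) (p : ℝ) : ℝ :=
  ∑ S : Finset W, ∑ v : W → Bool,
    (p / 2) ^ S.card * ((1 - p) / 2) ^ (Fintype.card W - S.card) * |cbias Φ S v|

end Generic

/-- `TRIBES_{w,m}`: an OR of `m` disjoint ANDs of width `w`. -/
def tribes (w m : ℕ) (x : Fin m × Fin w → Bool) : Bool :=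
  decide (∃ j : Fin m, ∀ i : Fin w, x (j, i) = true)

/-- The R2 combiner `TRIBES_{w,m} ∘ RM3_d^{m·w}`. -/
def tribesRM3 (w m d : ℕ) (y : (Fin m × Fin w) × (Fin d → Fin 3) → Bool) : Bool :=
  tribes w m fun ji => recMaj3 d fun u => y (ji, u)

/-- Calibration `m(w) = ⌊2^w · Σ_{j ≤ w} 1/(j 2^j)⌋ ≈ 2^w ln 2` (imbalance `|½ − (1−2^{-w})^{m(w)}| ≤ 2^{-w}`). -/
def mCal (w : ℕ) : ℕ := ⌊∑ j ∈ Finset.Icc 1 w, (2 : ℚ) ^ (w - j) / (j : ℚ)⌋₊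

/-- Calibration `d(w) = 10·(⌊log₂ w⌋ + 1)` (so `biasSeq p d(w) ≤ C_p · w^{-3}` by `biasSeq_decay`). -/
def dCal (w : ℕ) : ℕ := 10 * (Nat.log 2 w + 1)

/-- Tribe width as a function of the graph size and the ratio parameter `r`: `w = r·⌊log₂ n⌋`. -/
def wOf (n r : ℕ) : ℕ := r * Nat.log 2 n

/-- Block index type of the R2 slice. -/
abbrev HBlk (n r : ℕ) : Type :=
  (Fin (mCal (wOf n r)) × Fin (wOf n r)) × (Fin (dCal (wOf n r)) → Fin 3)

/-- Number of blocks `hP = m·w·3^d`. -/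
def hP (n r : ℕ) : ℕ := mCal (wOf n r) * wOf n r * 3 ^ dCal (wOf n r)

/-- The R2 slice function `TRIBES ∘ RM3 ∘ CLIQUE(n,kc)` on `hP(n,r)` graph blocks. -/
noncomputable def halfFn (n kc r : ℕ) (x : HBlk n r × Edge n → Bool) : Bool :=
  tribesRM3 (wOf n r) (mCal (wOf n r)) (dCal (wOf n r)) fun b => cliqueFn n kc fun e => x (b, e)

/-- Input length carrying `halfFn n kc r`: `2^{pair(r,kc)} · (2·hP·n² + 1)` (uniquely decodable: the 2-adic
valuation gives `(r,kc)`, the odd part gives `hP·n²`, which is strictly increasing in `n` for fixed `r`). -/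
def halfLen (n kc r : ℕ) : ℕ := 2 ^ Nat.pair r kc * (2 * (hP n r * n ^ 2) + 1)

/-- Right-hand side of the tribes bias response: imbalance + 2·√variance, `c = 2^{-w}`, `Q = biasSeq p d`. -/
noncomputable def tbRHS (w m d : ℕ) (p : ℝ) : ℝ :=
  |1 - 2 * (1 - ((1 : ℝ) / 2) ^ w) ^ m| +
    2 * Real.sqrt ((1 - 2 * ((1 : ℝ) / 2) ^ w + (((1 : ℝ) / 2) ^ w) ^ 2 * (1 + biasSeq p d) ^ w) ^ m
          - (1 - ((1 : ℝ) / 2) ^ w) ^ (2 * m))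

/-! ## Statements -/

/-- (A-gen) GENERIC MONOTONE AMPLIFICATION: O'Donnell's Theorem 1 for `{∧,∨,0,1}`-circuits with an abstract monotone
combiner `Φ` on `W` blocks (the landed A0–A6, A1, A2 verbatim; conclusion in terms of `expAbsBiasGen Φ (β/2)`). -/
def MonotoneAmplificationGen : Prop :=
  ∃ e : ℕ, ∀ β : ℝ, 0 < β → ∃ K : ℝ, 0 < K ∧
    ∀ (ι W : Type) [Fintype ι] [DecidableEq ι] [Fintype W] [DecidableEq W]
      (D : (ι → Bool) → ℝ) (f : (ι → Bool) → Bool) (Φ : (W → Bool) → Bool) (s : ℕ),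
      (∀ x, 0 ≤ D x) → ∑ x, D x = 1 → Monotone f → massAt D f true = 1 / 2 → Monotone Φ →
      (∀ C : Circuit ι, C.IsOver monotoneBasis01 → C.size ≤ s → agreeAt D f C.eval ≤ 1 - β) →
      ∀ M : Circuit (W × ι), M.IsOver monotoneBasis01 →
        ((M.size : ℝ) + 1) * K * (Fintype.card W : ℝ) ^ e ≤ s →
        agreeAt (fun x : W × ι → Bool => bw (fun _ : W => D) (fun w i => x (w, i)))
            (fun x => Φ fun w => f (fun i => x (w, i))) M.eval
          ≤ 1 / 2 + expAbsBiasGen Φ (β / 2) / 2 + (Fintype.card W : ℝ)⁻¹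

/-- (TB) TRIBES BIAS RESPONSE: `E_ρ |bias| ≤ |1 − 2(1−c)^m| + 2·√Var`, an exact second-moment identity + Cauchy–Schwarz. -/
def TribesBiasResponse : Prop :=
  ∀ (w m d : ℕ) (p : ℝ), 0 < p → p ≤ 1 → expAbsBiasGen (tribesRM3 w m d) p ≤ tbRHS w m d p

/-- (N) NUMERICS of the calibration: along `m = mCal w`, `d = dCal w` the TB bound is `≤ K₂·(m·w·3^d)^{-(1/2−ε)}`. -/
def TribesNumericsCal : Prop :=
  ∀ ε : ℝ, 0 < ε → ∀ p : ℝ, 0 < p → p ≤ 1 → ∃ K₂ : ℝ, 0 < K₂ ∧ ∀ᶠ w : ℕ in atTop,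
    tbRHS w (mCal w) (dCal w) p ≤ K₂ * (((mCal w * w * 3 ^ dCal w : ℕ) : ℝ)) ^ (-(1 / 2 - ε))

/-- (C) COUNT: the number of ones of `TRIBES_{w,m} ∘ RM3_d` is `2^{m w 3^d}·(1 − (1 − 2^{-w})^m)`. -/
def TribesRM3Count : Prop :=
  ∀ w m d : ℕ,
    (((Finset.univ : Finset ((Fin m × Fin w) × (Fin d → Fin 3) → Bool)).filter
        fun y => tribesRM3 w m d y = true).card : ℝ)
      = 2 ^ (m * w * 3 ^ d) * (1 - (1 - ((1 : ℝ) / 2) ^ w) ^ m)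

/-- (E′) ENGINE OUTPUT of the rung: for every ratio `r` and exponent `c`, `halfFn n kc r` is monotone, nearly balanced and
`(½ + K₃·hP^{-(1/2−ε₁)})`-hard under a probability FKG weight for `{∧,∨,0,1}`-circuits `M` with `(|M|+1)·K₃·hP^e ≤ n^c`. -/
def HalfEngine : Prop :=
  ∃ e : ℕ, ∀ ε₁ : ℝ, 0 < ε₁ → ∀ r c : ℕ, 1 ≤ r → ∃ kc : ℕ, 3 ≤ kc ∧ ∃ K₃ : ℝ, 0 < K₃ ∧
    ∀ᶠ n : ℕ in atTop, Monotone (halfFn n kc r) ∧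
      ∃ ν : (HBlk n r × Edge n → Bool) → ℝ, (∀ x, 0 ≤ ν x) ∧
        (∀ x y, ν x * ν y ≤ ν (x ⊓ y) * ν (x ⊔ y)) ∧ ∑ x, ν x = 1 ∧
        |massAt ν (halfFn n kc r) true - 1 / 2| ≤ K₃ * (hP n r : ℝ) ^ (-(1 / 2 - ε₁)) ∧
        ∀ M : Circuit (HBlk n r × Edge n), M.IsOver monotoneBasis01 →
          ((M.size : ℝ) + 1) * K₃ * (hP n r : ℝ) ^ e ≤ (n : ℝ) ^ c →
          agreeAt ν (halfFn n kc r) M.eval ≤ 1 / 2 + K₃ * (hP n r : ℝ) ^ (-(1 / 2 - ε₁))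

/-- (S′) NP plumbing: an NP language whose slice at `halfLen n kc r` (`3 ≤ kc < n`, `1 ≤ r`) is monotone and retracts onto
`halfFn n kc r` for negation-limited De Morgan size. -/
def HalfSlicesNP : Prop :=
  ∃ L ∈ Nondeterministic.NP, ∀ n kc r : ℕ, 3 ≤ kc → kc < n → 1 ≤ r →
    Monotone (L.sliceFn (halfLen n kc r)) ∧ ∀ b s : ℕ,
      (∀ D : Circuit (HBlk n r × Edge n), D.IsOver deMorganBasis →
        D.Computes (halfFn n kc r) → D.negationCount ≤ b → s ≤ D.size) →
      s ≤ negLimitedSizeOver deMorganBasis b (L.sliceFn (halfLen n kc r))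

/-- (T′) GAP-FORM NEGATION TRANSFER (no exact balance): FKG probability weight, monotone `f` with imbalance `≤ b ≤ 1/4`,
every monotone circuit of size `≤ |C|` agrees with `f` on mass `≤ 1/2 + a` ⟹ a De Morgan circuit computing `f` with
`≤ t` NOT gates forces `1 ≤ (2^{t+1} − 1)·(6a + 16b)`.  PROVED below from the tree. -/
def GapNegationsTransfer : Prop :=
  ∀ (ι : Type) [Fintype ι] [DecidableEq ι] (μ : (ι → Bool) → ℝ), (∀ x, 0 ≤ μ x) →
    (∀ x y, μ x * μ y ≤ μ (x ⊓ y) * μ (x ⊔ y)) → ∑ x, μ x = 1 →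
    ∀ f : (ι → Bool) → Bool, Monotone f → ∀ a b : ℝ, 0 ≤ a → 0 ≤ b → b ≤ 1 / 4 →
      |massAt μ f true - 1 / 2| ≤ b →
      ∀ (C : Circuit ι) (t : ℕ), C.IsOver deMorganBasis → C.Computes f → C.negationCount ≤ t →
        (∀ M : Circuit ι, M.IsOver monotoneBasis → M.size ≤ C.size → agreeAt μ f M.eval ≤ 1 / 2 + a) →
        (1 : ℝ) ≤ ((2 : ℝ) ^ (t + 1) - 1) * (6 * a + 16 * b)

/-- (EA′) engine assembly. -/
def HalfEngineAssembly : Prop :=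
  CriticalWindowHardness → MonotoneAmplificationGen → TribesBiasResponse → TribesNumericsCal →
    TribesRM3Count → HalfEngine

/-- (DA′) door assembly for the rung. -/
def HalfDoorAssembly : Prop :=
  GapNegationsTransfer → HalfSlicesNP → HalfEngine →
    Summit.PneNP.PneNP.Theses.NegLimited.NeglimitedHalfLogNegationsR

/-! ## Proved pieces -/

/-- `TRIBES_{w,m}` is monotone. -/
theorem tribes_monotone (w m : ℕ) : Monotone (tribes w m) := by
  intro x y hxy
  simp only [tribes]
  intro hx
  rw [decide_eq_true_iff] at hx ⊢
  obtain ⟨j, hj⟩ := hx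
  exact ⟨j, fun i => by have := hxy (j, i); rw [hj i] at this; exact this rfl⟩

/-- The R2 combiner `TRIBES_{w,m} ∘ RM3_d^{m·w}` is monotone. -/
theorem tribesRM3_monotone (w m d : ℕ) : Monotone (tribesRM3 w m d) := fun _ _ hxy =>
  tribes_monotone w m fun ji => recMaj3_monotone d fun u => hxy (ji, u)

/-- `jointAt ≤ massAt` termwise. -/
theorem jointAt_le_massAt {ι : Type} [Fintype ι] [DecidableEq ι] (μ : (ι → Bool) → ℝ) (hμ0 : ∀ x, 0 ≤ μ x)
    (f g : (ι → Bool) → Bool) (b : Bool) : jointAt μ f g b ≤ massAt μ f b := by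
  unfold jointAt massAt
  refine Finset.sum_le_sum fun x _ => ?_
  by_cases h1 : f x = b <;> by_cases h2 : g x = true <;> simp [h1, h2, hμ0]

/-- `jointAt` is nonnegative for a nonnegative weight. -/
theorem jointAt_nonneg {ι : Type} [Fintype ι] [DecidableEq ι] (μ : (ι → Bool) → ℝ) (hμ0 : ∀ x, 0 ≤ μ x)
    (f g : (ι → Bool) → Bool) (b : Bool) : 0 ≤ jointAt μ f g b :=
  by
  unfold jointAt
  exact Finset.sum_nonneg fun x _ => by split_ifs <;> simp [hμ0]

/-- (T′) `GapNegationsTransfer` PROVED from the tree's `NegLimitedDoor.one_le_negations_mul_gap` (p460402): with imbalance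
`≤ b ≤ 1/4` one has `m₀ m₁ ≥ 3/16`, and the conditional gap of any monotone test with agreement `≤ 1/2 + a` is `≤ a + 3b`. -/
theorem gapTransfer_holds : GapNegationsTransfer := by
  intro ι _ _ μ hμ0 hμ hμ1 f hf a b ha hb hb4 himb C t hC hCf ht hhard
  have hsum := NegLimitedDoor.massAt_false_add_massAt_true μ f
  rw [hμ1] at hsum
  set m₀ := massAt μ f false with hm₀
  set m₁ := massAt μ f true with hm₁
  have hm₁lo : 1 / 2 - b ≤ m₁ := by have := (abs_le.mp himb).1; linarith
  have hm₁hi : m₁ ≤ 1 / 2 + b := by have := (abs_le.mp himb).2; linarith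
  have hm₀lo : 1 / 2 - b ≤ m₀ := by linarith
  have hm₀hi : m₀ ≤ 1 / 2 + b := by linarith
  have hZ : 0 < m₀ * m₁ := by nlinarith
  have hprod : 3 / 16 ≤ m₀ * m₁ := by nlinarith
  refine NegLimitedDoor.one_le_negations_mul_gap μ hμ0 hμ f hf hZ C hC t ht hCf (6 * a + 16 * b) ?_
  intro M hM hMs
  have hagree := hhard M hM hMs
  have hJ0 := jointAt_le_massAt μ hμ0 f M.eval false
  have hJ0nn := jointAt_nonneg μ hμ0 f M.eval false
  have hJ1nn := jointAt_nonneg μ hμ0 f M.eval true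
  rw [NegLimitedDoor.agreeAt_eq] at hagree
  -- condGap = m₀ J₁ − m₁ J₀ ≤ m₀ (a + b) + 2 b ≤ a + 3 b ≤ (6a + 16b)·(3/16)
  have hgap : condGap μ f M.eval ≤ a + 3 * b := by
    unfold condGap
    rw [← hm₀, ← hm₁]
    have h1 : jointAt μ f M.eval true - jointAt μ f M.eval false ≤ a + b := by linarith
    have h2 : m₀ ≤ 1 := by linarith [NegLimitedDoor.massAt_nonneg hμ0 f true]
    nlinarith [NegLimitedDoor.massAt_nonneg hμ0 f false, NegLimitedDoor.massAt_nonneg hμ0 f true]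
  nlinarith

/-! ## Composition: the seven statements conclude the crux BY NAME (p3's kernel-checked modus ponens) -/


/-- The crux from the seven stub statements (p3's kernel-checked composition, verbatim; B = the landed `stub_criticalWindow`,
T′ = `gapTransfer_holds`). -/
theorem NeglimitedHalfLogNegationsR_of :
    MonotoneAmplificationGen → TribesBiasResponse → TribesNumericsCal → TribesRM3Count →
      HalfEngineAssembly → HalfSlicesNP → HalfDoorAssembly →
      Summit.PneNP.PneNP.Theses.NegLimited.NeglimitedHalfLogNegationsR :=
  fun hA hTB hN hC hEA hS hDA => hDA gapTransfer_holds hS (hEA stub_criticalWindow hA hTB hN hC)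

end Summit.PneNP.PneNP.Theorems.NegLimitedHalfWindow
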